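import Mathlib
import HarnessLib
import Summits.Ventures.LatticeQCDFlow.Scoring.SectorFreezingWindow
import Summits.Ventures.LatticeQCDFlow.Scoring.ChainMeanSquareError

/-!
# Freezing from a cold start: a run launched INSIDE a sector stays there for `N + 1` samples with
# probability `≥ μ₀(A) − N·φ`, `φ = sup_{y ∈ A} κ(y, Aᶜ)` — for the flow sampler `φ ≤ q(Aᶜ)`

HONEST FRAMING: exact (Metropolis-corrected) sampling algorithms for lattice gauge theory;
figures of merit are autocorrelation/cost numbers at stated couplings and volumes; no
continuum-physics claim.

Venture `LatticeQCDFlow` (cell pub-lqcd), topic `Scoring`; FANOUT row 8 (`s0-cpn-nemc`, GEN-13).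
NEW WORK of the cell, not a published result; no definition is introduced.  The stationary
freezing window of `Scoring/SectorFreezingWindow.lean` (`P_π(stay) ≥ π(A) − NΦ` with the
stationary flux `Φ`) is complemented by its non-stationary form, which is what practice meets: the
chain is started from a fixed configuration (or any law `μ₀`), and the exit probability per step is
bounded UNIFORMLY on the sector.  Inputs: the pointwise first-exit bound
(`one_sub_prod_indicator_le`), two-time moments from an arbitrary start
(`Scoring/ChainMeanSquareError.chain_twoTime_initial`), the initial marginal
(`Scoring/ChainBurnIn.chain_initial`), and row 30's sector-entry bound for the flow-MCMC kernel
(`Exactness.indepMH_apply_le_of_not_mem`: from `y ∈ A`, `K(y, Aᶜ) ≤ q(Aᶜ)`).  No invariance, no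
reversibility, no Doeblin hypothesis is used.  Nothing is cited as a fact.

## Content (`κ` Markov; `μ₀` ANY probability law; `A` measurable; `φ ≥ 0` with
## `κ(y, Aᶜ) ≤ φ` for all `y ∈ A`)

* `chain_exitPair_le_of_initial` — `E_{μ₀}[1_A(X_i)(1 − 1_A(X_{i+1}))] ≤ φ` for every `i`;
* **`chain_stay_ge_of_initial`** — `P_{μ₀}(X_0 ∈ A, …, X_N ∈ A) ≥ μ₀(A) − N φ`;
* **`indepMH_stay_ge_of_initial`** — for the flow-MCMC kernel `indepMH q w` (any measurable weight):
  `P_{μ₀}(X_0, …, X_N ∈ A) ≥ μ₀(A) − N q(Aᶜ)`; from a start inside the sector (`μ₀(A) = 1`):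
  `≥ 1 − N q(Aᶜ)` — a model that proposes the other sectors with probability `q(Aᶜ)` keeps the
  exact sampler in the starting sector for `N + 1 ≤ 1/q(Aᶜ)` samples, whatever the target weights.

NOT CLAIMED: any `q(Aᶜ)` for a concrete flow; that the bound is sharp; anything about which sector
is the right one (the statement is symmetric in the sectors).
-/

noncomputable section

namespace Summit.Ventures.LatticeQCDFlow.Scoring

open MeasureTheory ProbabilityTheory Filter Finset Preorder Set
open Summit.Ventures.LatticeQCDFlow.Exactness
open scoped ENNReal

variable {Ω : Type*} [MeasurableSpace Ω]

section Chain

variable {κ : Kernel Ω Ω} [IsMarkovKernel κ] {μ₀ : Measure Ω} [IsProbabilityMeasure μ₀] {A : Set Ω}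

/-- **Exit pairs from any start**: if `κ(y, Aᶜ) ≤ φ` for every `y ∈ A` (`φ ≥ 0`), then
`E_{μ₀}[1_A(X_i)(1 − 1_A(X_{i+1}))] ≤ φ` for every initial law and every `i`. -/
theorem chain_exitPair_le_of_initial (hA : MeasurableSet A) {φ : ℝ} (hφ0 : 0 ≤ φ)
    (hφ : ∀ y ∈ A, (κ y).real Aᶜ ≤ φ) (i : ℕ) :
    ∫ x, A.indicator (1 : Ω → ℝ) (x i) * (1 - A.indicator (1 : Ω → ℝ) (x (i + 1)))
        ∂(Kernel.trajMeasure (X := fun _ : ℕ => Ω) μ₀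
          (fun n : ℕ => κ.comap (fun h : (j : ↥(Finset.Iic n)) → Ω => h ⟨n, Finset.mem_Iic.2 le_rfl⟩)
            (measurable_pi_apply _)))
      ≤ φ := by
  have h1m : Measurable (A.indicator (1 : Ω → ℝ)) := measurable_const.indicator hA
  have h1b : ∀ y, |A.indicator (1 : Ω → ℝ) y| ≤ 1 := fun y => by
    by_cases hy : y ∈ A <;> simp [hy]
  have hcm : Measurable fun y => 1 - A.indicator (1 : Ω → ℝ) y := measurable_const.sub h1m
  have hcb : ∀ y, |1 - A.indicator (1 : Ω → ℝ) y| ≤ 1 := fun y => by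
    by_cases hy : y ∈ A <;> simp [hy]
  -- the two-time moment as `∫ K^i (1_A · K(1 − 1_A)) dμ₀`
  rw [chain_twoTime_initial κ μ₀ i 1 hcm hcb h1m h1b]
  simp only [Function.iterate_one]
  -- the one-step observable `h(y) = 1_A(y) κ(y, Aᶜ)` is between `0` and `φ`
  have hkop : ∀ y, kop κ (fun z => 1 - A.indicator (1 : Ω → ℝ) z) y = (κ y).real Aᶜ := fun y => by
    unfold kop
    rw [integral_sub (integrable_const _) (integrable_indicator_one hA), integral_const,
      probReal_univ, one_smul, integral_indicator_one hA, measureReal_compl hA, probReal_univ]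
  have hhm : Measurable fun y => A.indicator (1 : Ω → ℝ) y
      * kop κ (fun z => 1 - A.indicator (1 : Ω → ℝ) z) y := h1m.mul (measurable_kop κ hcm)
  have hh0 : ∀ y, 0 ≤ A.indicator (1 : Ω → ℝ) y * kop κ (fun z => 1 - A.indicator (1 : Ω → ℝ) z) y :=
    fun y => by
    rw [hkop]
    exact mul_nonneg (Set.indicator_nonneg (fun _ _ => zero_le_one) _) measureReal_nonneg
  have hhφ : ∀ y, A.indicator (1 : Ω → ℝ) y * kop κ (fun z => 1 - A.indicator (1 : Ω → ℝ) z) y ≤ φ :=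
    fun y => by
    rw [hkop]
    by_cases hy : y ∈ A
    · rw [Set.indicator_of_mem hy, Pi.one_apply, one_mul]; exact hφ y hy
    · rw [Set.indicator_of_notMem hy, zero_mul]; exact hφ0
  have hhb : ∀ y, |A.indicator (1 : Ω → ℝ) y * kop κ (fun z => 1 - A.indicator (1 : Ω → ℝ) z) y| ≤ φ :=
    fun y => by rw [abs_of_nonneg (hh0 y)]; exact hhφ y
  obtain ⟨-, hKb⟩ := iterate_kop_bounded_measurable κ hhm hhb i
  calc ∫ y, (kop κ)^[i] (fun y => A.indicator (1 : Ω → ℝ) y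
          * kop κ (fun z => 1 - A.indicator (1 : Ω → ℝ) z) y) y ∂μ₀
      ≤ ∫ _, φ ∂μ₀ := integral_mono_of_nonneg (ae_of_all _ fun y => ?_) (integrable_const _)
          (ae_of_all _ fun y => (le_abs_self _).trans (hKb y))
    _ = φ := by rw [integral_const, probReal_univ, one_smul]
  -- nonnegativity of the iterate of a nonnegative observable
  clear hKb
  induction i generalizing y with
  | zero => exact hh0 y
  | succ i ih =>
    rw [Function.iterate_succ_apply']
    exact integral_nonneg fun z => ih z

/-- **STAYING IN THE SECTOR FROM ANY START**: with `κ(y, Aᶜ) ≤ φ` on `A` (`φ ≥ 0`), for every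
initial law `μ₀` and every `N`: `P_{μ₀}(X_0 ∈ A, …, X_N ∈ A) ≥ μ₀(A) − N φ`. -/
theorem chain_stay_ge_of_initial (hA : MeasurableSet A) {φ : ℝ} (hφ0 : 0 ≤ φ)
    (hφ : ∀ y ∈ A, (κ y).real Aᶜ ≤ φ) (N : ℕ) :
    μ₀.real A - N * φ
      ≤ (Kernel.trajMeasure (X := fun _ : ℕ => Ω) μ₀
          (fun n : ℕ => κ.comap (fun h : (j : ↥(Finset.Iic n)) → Ω => h ⟨n, Finset.mem_Iic.2 le_rfl⟩)
            (measurable_pi_apply _))).real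
        {x | ∀ i ∈ Finset.range (N + 1), x i ∈ A} := by
  set P := Kernel.trajMeasure (X := fun _ : ℕ => Ω) μ₀
      (fun n : ℕ => κ.comap (fun h : (j : ↥(Finset.Iic n)) → Ω => h ⟨n, Finset.mem_Iic.2 le_rfl⟩)
        (measurable_pi_apply _)) with hP
  set S := {x : ℕ → Ω | ∀ i ∈ Finset.range (N + 1), x i ∈ A} with hS
  have h1m : Measurable (A.indicator (1 : Ω → ℝ)) := measurable_const.indicator hA
  have h1b : ∀ y, |A.indicator (1 : Ω → ℝ) y| ≤ 1 := fun y => by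
    by_cases hy : y ∈ A <;> simp [hy]
  have hSm : MeasurableSet S := by
    have : S = ⋂ i ∈ Finset.range (N + 1), (fun x : ℕ → Ω => x i) ⁻¹' A := by
      ext x; simp [hS]
    rw [this]
    exact Finset.measurableSet_biInter _ fun i _ => measurable_pi_apply i hA
  have hprod : ∀ x : ℕ → Ω, ∏ i ∈ Finset.range (N + 1), A.indicator (1 : Ω → ℝ) (x i)
      = S.indicator (1 : (ℕ → Ω) → ℝ) x := fun x => by
    by_cases hx : x ∈ S
    · rw [Set.indicator_of_mem hx, Pi.one_apply]
      exact Finset.prod_eq_one fun i hi => by rw [Set.indicator_of_mem (hx i hi), Pi.one_apply]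
    · rw [Set.indicator_of_notMem hx]
      obtain ⟨i, hi, hxi⟩ : ∃ i ∈ Finset.range (N + 1), x i ∉ A := by
        by_contra hcon
        exact hx fun i hi => by_contra fun hxi => hcon ⟨i, hi, hxi⟩
      exact Finset.prod_eq_zero hi (by rw [Set.indicator_of_notMem hxi])
  have hPS : P.real S = ∫ x, ∏ i ∈ Finset.range (N + 1), A.indicator (1 : Ω → ℝ) (x i) ∂P := by
    simp_rw [hprod]
    exact (integral_indicator_one hSm).symm
  have hint_prod : Integrable (fun x : ℕ → Ω =>
      ∏ i ∈ Finset.range (N + 1), A.indicator (1 : Ω → ℝ) (x i)) P := by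
    simp_rw [hprod]
    exact integrable_indicator_one hSm
  have hi0' : Integrable (fun x : ℕ → Ω => A.indicator (1 : Ω → ℝ) (x 0)) P :=
    integrable_of_bounded P (h1m.comp (measurable_pi_apply 0)) fun x => h1b (x 0)
  have hint0 : Integrable (fun x : ℕ → Ω => 1 - A.indicator (1 : Ω → ℝ) (x 0)) P :=
    (integrable_const _).sub hi0'
  have hint_pair : ∀ i, Integrable (fun x : ℕ → Ω => A.indicator (1 : Ω → ℝ) (x i)
      * (1 - A.indicator (1 : Ω → ℝ) (x (i + 1)))) P := fun i =>
    integrable_of_bounded P ((h1m.comp (measurable_pi_apply i)).mul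
      (measurable_const.sub (h1m.comp (measurable_pi_apply (i + 1))))) (C := 1 * 1) fun x => by
      rw [abs_mul]
      refine mul_le_mul (h1b _) ?_ (abs_nonneg _) zero_le_one
      by_cases hy : x (i + 1) ∈ A <;> simp [hy]
  have hLi : Integrable (fun x : ℕ → Ω =>
      1 - ∏ i ∈ Finset.range (N + 1), A.indicator (1 : Ω → ℝ) (x i)) P :=
    (integrable_const _).sub hint_prod
  have hsum_i : Integrable (fun x : ℕ → Ω => ∑ i ∈ Finset.range N,
      A.indicator (1 : Ω → ℝ) (x i) * (1 - A.indicator (1 : Ω → ℝ) (x (i + 1)))) P :=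
    integrable_finsetSum _ fun i _ => hint_pair i
  have hRi : Integrable (fun x : ℕ → Ω => (1 - A.indicator (1 : Ω → ℝ) (x 0))
      + ∑ i ∈ Finset.range N,
          A.indicator (1 : Ω → ℝ) (x i) * (1 - A.indicator (1 : Ω → ℝ) (x (i + 1)))) P :=
    hint0.add hsum_i
  have hbound := integral_mono hLi hRi (fun x => one_sub_prod_indicator_le A x N)
  rw [integral_sub (integrable_const _) hint_prod, integral_add hint0 hsum_i,
    integral_finsetSum _ (fun i _ => hint_pair i),
    integral_sub (integrable_const _) hi0', integral_const, probReal_univ, one_smul] at hbound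
  -- the initial marginal and the exit pairs
  have hinit : ∫ x, A.indicator (1 : Ω → ℝ) (x 0) ∂P = μ₀.real A := by
    rw [hP, chain_initial κ μ₀ h1m]
    exact integral_indicator_one hA
  have hpairs : ∑ i ∈ Finset.range N, ∫ x, A.indicator (1 : Ω → ℝ) (x i)
      * (1 - A.indicator (1 : Ω → ℝ) (x (i + 1))) ∂P ≤ N * φ := by
    calc ∑ i ∈ Finset.range N, ∫ x, A.indicator (1 : Ω → ℝ) (x i)
          * (1 - A.indicator (1 : Ω → ℝ) (x (i + 1))) ∂P
        ≤ ∑ _i ∈ Finset.range N, φ := Finset.sum_le_sum fun i _ => by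
            rw [hP]; exact chain_exitPair_le_of_initial (μ₀ := μ₀) hA hφ0 hφ i
      _ = N * φ := by rw [Finset.sum_const, Finset.card_range, nsmul_eq_mul]
  rw [hinit] at hbound
  rw [hPS]
  linarith

end Chain

/-! ### The flow-MCMC kernel: a collapsed model freezes the run from a cold start -/

section IndepMH

variable {q : Measure Ω} [IsProbabilityMeasure q] {w : Ω → ℝ} {μ₀ : Measure Ω}
  [IsProbabilityMeasure μ₀] {A : Set Ω}

/-- **MODE COLLAPSE FREEZES THE RUN FROM ANY START.**  For the flow-MCMC kernel `indepMH q w` (any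
measurable weight `w`), every measurable sector `A`, every initial law `μ₀` and every `N`:
`P_{μ₀}(X_0 ∈ A, …, X_N ∈ A) ≥ μ₀(A) − N q(Aᶜ)`; in particular a run started inside the sector stays
there for `N + 1` samples with probability `≥ 1 − N q(Aᶜ)`. -/
theorem indepMH_stay_ge_of_initial (hw : Measurable w) (hA : MeasurableSet A) (N : ℕ) :
    haveI : Fact (Measurable w) := ⟨hw⟩
    μ₀.real A - N * q.real Aᶜ
      ≤ (Kernel.trajMeasure (X := fun _ : ℕ => Ω) μ₀
          (fun n : ℕ => (indepMH q w).comap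
            (fun h : (j : ↥(Finset.Iic n)) → Ω => h ⟨n, Finset.mem_Iic.2 le_rfl⟩) (measurable_pi_apply _))).real
        {x | ∀ i ∈ Finset.range (N + 1), x i ∈ A} := by
  haveI : Fact (Measurable w) := ⟨hw⟩
  refine chain_stay_ge_of_initial (κ := indepMH q w) hA measureReal_nonneg (fun y hy => ?_) N
  rw [measureReal_def, measureReal_def]
  exact ENNReal.toReal_mono (measure_ne_top _ _)
    (indepMH_apply_le_of_not_mem hw hA.compl (fun h => h hy))

/-- … and then the sector-weight time average is off by `1 − π(A)` (for any reference value
`a ≤ 1`, `|1 − a| ≥ 1 − a`): `P_{μ₀}(|(1/(N+1)) Σ_{i≤N} 1_A(X_i) − a| ≥ 1 − a) ≥ μ₀(A) − N q(Aᶜ)`. -/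
theorem indepMH_freezing_of_initial (hw : Measurable w) (hA : MeasurableSet A) (N : ℕ) {a : ℝ}
    (ha : a ≤ 1) :
    haveI : Fact (Measurable w) := ⟨hw⟩
    μ₀.real A - N * q.real Aᶜ
      ≤ (Kernel.trajMeasure (X := fun _ : ℕ => Ω) μ₀
          (fun n : ℕ => (indepMH q w).comap
            (fun h : (j : ↥(Finset.Iic n)) → Ω => h ⟨n, Finset.mem_Iic.2 le_rfl⟩) (measurable_pi_apply _))).real
        {x | 1 - a ≤ |(∑ i ∈ Finset.range (N + 1), A.indicator (1 : Ω → ℝ) (x i)) / (N + 1 : ℕ) - a|} := by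
  haveI : Fact (Measurable w) := ⟨hw⟩
  refine (indepMH_stay_ge_of_initial (μ₀ := μ₀) hw hA N).trans (measureReal_mono fun x hx => ?_)
  simp only [Set.mem_setOf_eq] at hx ⊢
  have hsum : ∑ i ∈ Finset.range (N + 1), A.indicator (1 : Ω → ℝ) (x i) = (N + 1 : ℕ) := by
    rw [Finset.sum_congr rfl fun i hi => by rw [Set.indicator_of_mem (hx i hi), Pi.one_apply],
      Finset.sum_const, Finset.card_range, nsmul_eq_mul, mul_one]
  have hN : ((N + 1 : ℕ) : ℝ) ≠ 0 := by exact_mod_cast Nat.succ_ne_zero N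
  rw [hsum, div_self hN, abs_of_nonneg (by linarith)]

end IndepMH

end Summit.Ventures.LatticeQCDFlow.Scoring

end
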